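import Summits.Langlands.Langlands.Theses.PhantomRMYoshida
import Summits.Langlands.Langlands.Theses.WachComponentCensus
import Literature.NumberTheory.Automorphic.LocalLanglandsDatumProofs

/-!
# BIRTH SKELETON — piece N `CanonicalReciprocityData` of the split of `PhantomRMYoshida.PhantomRMJunction`
(stmt-Langlands-13643; the piece is item stmt-Langlands-17930 = `WachComponentCensus.CanonicalReciprocityData`
verbatim). Crux-strategist planner-cstrat-stmt-Langlands-13643-r1-0, 2026-08-17.

`N := ∀ F, Nonempty (Summit.Langlands.ReciprocityData F)`: canonically normalised local Langlands data at
every completion of every number field. The six threaded `LocalGaloisGroup` facts are discharged in the tree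
(`IsFrobPow.mul_holds`, …, `isOpen_ker_quasiChar_holds`); the local Artin map is pinned by specification
(`canonicalArtin`). What is NOT in the tree is (S_N1) a system of local constants normalised against THE
Artin maps of every finite extension (Deligne 1973 Thm 4.1 for the canonical maps — the named fact
`nonempty_localEpsilonSystem` gives SOME normalisation only) and (S_N2) the local Langlands correspondence for
every normalising pair (the named fact `localLanglands_gl`, Harris–Taylor Thm A / Henniart 2000; T0 debt).

  `CanonicalReciprocityData_of : S_N1 → S_N2 → N`   (sorry-free: package, per completion, the datum
  `(𝓔.artin F_v, 𝓔, rec)` with the discharged threaded facts, then `choose` over `v`).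

Registered stubs (the only sorries): `stub_canonicalEpsilonSystem` (S_N1), `stub_localLanglands_gl` (S_N2).
-/

noncomputable section

set_option linter.dupNamespace false

open scoped MatrixGroups NumberField
open NumberField IsDedekindDomain
open Literature.NumberTheory.Automorphic Literature.NumberTheory.GaloisRepresentations
open Literature.NumberTheory.GaloisRepresentations.WeilGroup
open Summit.Langlands

namespace Summit.Langlands.Langlands.Cruxes.PhantomRMJunction.BirthN

/-- **Stub S_N1 — Deligne's local constants FOR THE CANONICAL ARTIN MAPS.** Over every non-archimedean
local field there is a system of local constants whose Artin datum at every finite extension `E` is the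
pinned one (`LocalArtinData.IsCanonical`). Deligne 1973 Thm 4.1 (existence) is proved for the Artin maps of
local class field theory, which are THE maps `canonicalArtin E` under `IsLocalArtinMap.unique` (in tree:
`IsLocalArtinMap.unique_holds`, `exists_isLocalArtinMap_holds`). [cite: Deligne1973, Thm. 4.1]
[cite: SerreLocalFields1979, Ch. XIII §4 Thm. 1–2] -/
theorem stub_canonicalEpsilonSystem :
    ∀ (F : Type) [Field F] [ValuativeRel F] [TopologicalSpace F] [IsNonarchimedeanLocalField F],
      ∃ 𝓔 : LocalEpsilonSystem F, ∀ (E : Type) [Field E] [ValuativeRel E] [TopologicalSpace E]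
        [IsNonarchimedeanLocalField E] [Algebra F E] [FiniteDimensional F E],
          (𝓔.artin E).IsCanonical := by
  sorry

/-- **Stub S_N2 — the local Langlands correspondence for `GL_n` for every normalising pair** (the tree's
named fact `localLanglands_gl`: Harris–Taylor 2001 Thm A; Henniart 2000 Thm 1.2; uniqueness on supercuspidals
Henniart 1993 Thm 1.1). [cite: HarrisTaylorAMS2001, Thm. A] [cite: HenniartInventiones2000, Thm. 1.2] -/
theorem stub_localLanglands_gl :
    ∀ (F : Type) [Field F] [ValuativeRel F] [TopologicalSpace F] [IsNonarchimedeanLocalField F]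
      (hmul : IsFrobPow.mul (F := F)) (huniq : IsFrobPow.unique (F := F))
      (hn : absInertia_normal F) (hex : exists_isFrobPow (F := F))
      (hns : WeilGroup.exists_subgroup_le_inertia_isOpen_of_continuous (F := F))
      (d : LocalArtinData F) (𝓔 : LocalEpsilonSystem F) (hd : 𝓔.artin F = d),
      localLanglands_gl F hmul huniq hn hex hns d 𝓔 hd := by
  sorry

/-- **N from the two stub STATEMENTS**, concluding the TEXT of the piece (= item stmt-Langlands-17930 =
the child `PhantomRMYoshida.CanonicalReciprocityData` once the split is installed; all definitionally equal).
Sorry-free: package, per completion, the datum `(𝓔.artin F_v, 𝓔, rec)` with the discharged threaded facts,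
then `choose` over `v`. -/
theorem canonicalReciprocityData_text_of
    (heps : ∀ (F : Type) [Field F] [ValuativeRel F] [TopologicalSpace F] [IsNonarchimedeanLocalField F],
      ∃ 𝓔 : LocalEpsilonSystem F, ∀ (E : Type) [Field E] [ValuativeRel E] [TopologicalSpace E]
        [IsNonarchimedeanLocalField E] [Algebra F E] [FiniteDimensional F E],
          (𝓔.artin E).IsCanonical)
    (hgl : ∀ (F : Type) [Field F] [ValuativeRel F] [TopologicalSpace F] [IsNonarchimedeanLocalField F]
      (hmul : IsFrobPow.mul (F := F)) (huniq : IsFrobPow.unique (F := F))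
      (hn : absInertia_normal F) (hex : exists_isFrobPow (F := F))
      (hns : WeilGroup.exists_subgroup_le_inertia_isOpen_of_continuous (F := F))
      (d : LocalArtinData F) (𝓔 : LocalEpsilonSystem F) (hd : 𝓔.artin F = d),
      localLanglands_gl F hmul huniq hn hex hns d 𝓔 hd) :
    ∀ (K : Type) [Field K] [NumberField K], Nonempty (Summit.Langlands.ReciprocityData K) := by
  intro K _ _
  have key : ∀ v : HeightOneSpectrum (𝓞 K), ∃ L : LocalLanglandsDatum (v.adicCompletion K),
      L.artin.IsCanonical ∧ ∀ (E : Type) [Field E] [ValuativeRel E] [TopologicalSpace E]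
        [IsNonarchimedeanLocalField E] [Algebra (v.adicCompletion K) E]
        [FiniteDimensional (v.adicCompletion K) E], (L.eps.artin E).IsCanonical := by
    intro v
    obtain ⟨𝓔, h𝓔⟩ := heps (v.adicCompletion K)
    obtain ⟨rec, hrec, -⟩ := hgl (v.adicCompletion K) IsFrobPow.mul_holds IsFrobPow.unique_holds
      (absInertia_normal_holds _) (exists_isFrobPow_holds _)
      WeilGroup.exists_subgroup_le_inertia_isOpen_of_continuous_holds (𝓔.artin _) 𝓔 rfl
    exact ⟨{ hmul := IsFrobPow.mul_holds, huniq := IsFrobPow.unique_holds,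
             hn := absInertia_normal_holds _, hex := exists_isFrobPow_holds _,
             hns := WeilGroup.exists_subgroup_le_inertia_isOpen_of_continuous_holds,
             hqc := isOpen_ker_quasiChar_holds, artin := 𝓔.artin _, eps := 𝓔, eps_artin := rfl,
             recGL := rec, isLocalLanglands := hrec },
      h𝓔 _, fun E _ _ _ _ _ _ ↦ h𝓔 E⟩
  choose L hL hLE using key
  exact ⟨⟨L, hL, fun v E _ _ _ _ _ _ ↦ hLE v E⟩⟩

/-- **SKELETON COMPOSITION** — the piece BY NAME from the registered stubs (the only sorries of the file
are inside `stub_canonicalEpsilonSystem`, `stub_localLanglands_gl`). -/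
theorem CanonicalReciprocityData_proof :
    Summit.Langlands.Langlands.Theses.WachComponentCensus.CanonicalReciprocityData :=
  canonicalReciprocityData_text_of stub_canonicalEpsilonSystem stub_localLanglands_gl

end Summit.Langlands.Langlands.Cruxes.PhantomRMJunction.BirthN

end
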